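import Literature.NumberTheory.K2Lit.LocalDoublingUnramifiedHecke
import Literature.NumberTheory.GaloisRepresentations.HeckeCharacterFiniteIdeleValuesProofs
import Literature.NumberTheory.Automorphic.AdelicVectorHeightGalois
import Literature.NumberTheory.GelbartRogawski1991.DoubledWeilRepresentationArchLagrangian
import Summits.HodgeConjecture.HodgeConjecture.Theorems.K2LiuSplitCartanIwasawa

/-!
# `Λ_{s,v}` on the Cartan representatives at a split place — the closed form (LOCAL SEAM of s23, file #27)

Track B ∕ K2-LIT, hLiu418 = stmt-HodgeConjecture-24832; DEPMAP `Cruxes/HLiu418/Lines/K2_Liu_LocalSeam_s23.md` §3 file #27 and §7 (K2Liu-plan (g1)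
PIN §1, «=» 2026-09-04 00:06:27Z). Helper (count-neutral, own head per LEAD R3): for the K2Lit datum `(L, e, dV, dW)`, a finite place `v` of
`L⁺` SPLIT in `L` (`w ∣ v`, `c w ≠ w`) that is good for the doubled lattice (`T₀ = gramR` integral at `w` with unit determinant — all but
finitely many `v`), a Hecke character `χ` of `L` unramified above `v` (ANY such `χ`), a uniformizer `ϖ` of `L_w` and `t ∈ G_v = U(V)(L⁺_v)`
whose `w`-component is `diag(ϖ^{m_i})_i` (`m : Fin N → ℤ`):

  `Λ_{s,v}(ι_v(t, 1)) = χ(ϖ_w)^{M⁺} · χ(ϖ_{w̄})^{M⁻} · ‖ϖ‖_w^{(M⁺ + M⁻)(s + n/2)}`,  `M^± = M · ∑_i max(±m_i, 0)`, `w̄ = c⁻¹ w`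

(`lambdaLoc_iotaLeftLocPi_diagonal_split`; `Λ_{s,v}` = ★ D7c `LambdaLoc`, `ι_v(·,1)` = ★ D7a `iotaLeftLocPi`, `χ(ϖ_w)` = ★ `HeckeCharacter.valueAtUniformizer`,
`M` = rank of `W`, `n = N·M`; `‖ϖ‖_w = q_w⁻¹ = q_v⁻¹`). Proof: ★ `K2LiuSplitCartanIwasawa.exists_isSiegelDelta_mul_localInt_of_diagonal` (explicit
`ι_v(t,1) = p·k`, `det_Δ p_w = ϖ^{M⁺}`, `c_*(det_Δ p_{w̄}) = ϖ^{M⁻}`) + ★ `lambdaLoc_mul_eq` + ★ `siegelCharLoc_eq_localSiegelCharacter_of_mem` + ★ `univ_eq_pair`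
+ ★ `coe_map_localUnits_eq_valueAtUniformizer_zpow` + ★ `norm_galAdicCompletionMap`. This is the summand of the local doubling zeta integral on the
double coset `K_v t K_v` ([Li1992, §3 Thm. 3.1]; [GelbartPiatetskishapiroRallis1987, Part A §6]; [Liu2011, §2C (2-4) p. 863]) consumed by #28s–#30.
No `def`, no `sorry`. HONEST LABEL: HC_CM is proved only modulo the printed citations (2 remaining named inputs: hLiu418 = stmt-HodgeConjecture-24832,
h413 = stmt-HodgeConjecture-24833) until rung 0 closes; this file is unconditional and moves no counter.
-/

set_option autoImplicit false

set_option linter.dupNamespace false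

noncomputable section

open scoped Matrix Kronecker
open NumberField IsDedekindDomain Matrix

namespace Summit.HodgeConjecture.HodgeConjecture.Cruxes.HLiu418.K2LiuUnramifiedSectionOnCartan

open Literature.NumberTheory.Automorphic Literature.NumberTheory.Automorphic.UnitaryGroup Literature.NumberTheory.GaloisRepresentations
open Literature.NumberTheory.GelbartRogawski1991 Literature.NumberTheory.GelbartRogawski1991.GRConstruction
open Literature.NumberTheory.GelbartRogawski1991.UnitaryDualPair
open Literature.NumberTheory.K2Lit Literature.NumberTheory.K2Lit.SiegelDoubled
open Summit.HodgeConjecture.HodgeConjecture.Cruxes.HLiu418.K2LiuSplitCartanIwasawa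

variable (L : Type) [Field L] [NumberField L] [IsCMField L]
variable {N M n : ℕ} (e : Fin N × Fin M ≃ Fin n)
  (dV : Fin N → L) (hdV : ∀ i, IsCMField.complexConj L (dV i) = dV i)
  (dW : Fin M → L) (hdW : ∀ i, IsCMField.complexConj L (dW i) = dW i)
  (v : HeightOneSpectrum (𝓞 (Fp L)))

/-! ## §1 Uniformizer powers -/

section Powers

variable {K : Type} [Field K]

omit [NumberField L] [IsCMField L] in
/-- `∏_j (m_j ≥ 0 ? ϖ^{m_j} : 1) = ϖ^{∑_j max(m_j, 0)}`. [cite: Li1992, §3] -/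
theorem prod_ite_zpow_eq_pow_sum_toNat (ϖ : K) (m : Fin n → ℤ) (P : Fin n → Prop) [DecidablePred P] (hP : ∀ j, P j ↔ 0 ≤ m j) :
    (∏ j, if P j then ϖ ^ m j else 1) = ϖ ^ ∑ j, (m j).toNat := by
  rw [← Finset.prod_pow_eq_pow_sum]
  refine Finset.prod_congr rfl fun j _ => ?_
  by_cases hj : 0 ≤ m j
  · rw [if_pos ((hP j).2 hj), ← zpow_natCast, Int.toNat_of_nonneg hj]
  · rw [if_neg (mt (hP j).1 hj), Int.toNat_eq_zero.2 (not_le.1 hj).le, pow_zero]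

omit [NumberField L] [IsCMField L] in
/-- `(∏_j (m_j ≥ 0 ? 1 : ϖ^{m_j}))⁻¹ = ϖ^{∑_j max(−m_j, 0)}`. [cite: Li1992, §3] -/
theorem inv_prod_ite_zpow_eq_pow_sum_toNat (ϖ : K) (m : Fin n → ℤ) (P : Fin n → Prop) [DecidablePred P] (hP : ∀ j, P j ↔ 0 ≤ m j) :
    (∏ j, if P j then (1 : K) else ϖ ^ m j)⁻¹ = ϖ ^ ∑ j, (-(m j)).toNat := by
  rw [← Finset.prod_pow_eq_pow_sum, ← Finset.prod_inv_distrib]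
  refine Finset.prod_congr rfl fun j _ => ?_
  by_cases hj : 0 ≤ m j
  · rw [if_pos ((hP j).2 hj), inv_one, Int.toNat_eq_zero.2 (neg_nonpos.2 hj), pow_zero]
  · rw [if_neg (mt (hP j).1 hj), ← zpow_natCast, Int.toNat_of_nonneg (neg_nonneg.2 (not_le.1 hj).le), _root_.zpow_neg]

omit [NumberField L] [IsCMField L] in
/-- re-indexing the exponents along `e : Fin N × Fin M ≃ Fin n`: `∑_j f((e⁻¹ j).1) = M · ∑_i f(i)`. [cite: Li1992, §3] -/
theorem sum_comp_symm_fst (f : Fin N → ℕ) : ∑ j, f (e.symm j).1 = M * ∑ i, f i := by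
  rw [Fintype.sum_equiv e.symm (fun j => f (e.symm j).1) (fun p => f p.1) (fun _ => rfl), Fintype.sum_prod_type, Finset.mul_sum]
  refine Finset.sum_congr rfl fun i _ => ?_
  simp only [Finset.sum_const, Finset.card_univ, Fintype.card_fin, smul_eq_mul]

end Powers

/-! ## §2 Valuation bookkeeping in `L_w` -/

omit [IsCMField L] in
/-- for a uniformizer `ϖ` of `L_w`: `|ϖ^k|_w ≤ 1 ↔ 0 ≤ k` (in the `ValuativeRel` spelling of the GR91 local API). [cite: CasselsFrohlichANT1967, Ch. II §10] -/
theorem valuation_zpow_le_one_iff {w : HeightOneSpectrum (𝓞 L)} {ϖ : w.adicCompletion L}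
    (hϖ : Valued.v ϖ = WithZero.exp (-1 : ℤ)) (k : ℤ) :
    ValuativeRel.valuation (w.adicCompletion L) (ϖ ^ k) ≤ 1 ↔ 0 ≤ k := by
  rw [(ValuativeRel.isEquiv (ValuativeRel.valuation (w.adicCompletion L)) (Valued.v : Valuation (w.adicCompletion L) _)).le_one_iff_le_one,
    map_zpow₀, hϖ]
  exact zpow_le_one_iff_right_of_lt_one₀ WithZero.exp_pos (by rw [← WithZero.exp_zero, WithZero.exp_lt_exp]; norm_num)

omit [IsCMField L] in
/-- `−log |ϖ^k|_w = k` for a uniformizer `ϖ`. [cite: CasselsFrohlichANT1967, Ch. II §10] -/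
theorem neg_log_valued_pow {w : HeightOneSpectrum (𝓞 L)} {ϖ : w.adicCompletion L}
    (hϖ : Valued.v ϖ = WithZero.exp (-1 : ℤ)) (k : ℕ) :
    -(WithZero.log (Valued.v (ϖ ^ k))) = (k : ℤ) := by
  rw [map_pow, hϖ, WithZero.log_pow, WithZero.log_exp, smul_neg, neg_neg, nsmul_eq_mul, mul_one]

/-! ## §3 The closed form -/

/-- **`Λ_{s,v}` on the Cartan representatives at a split place** (DEPMAP §7 (#27)): for `t ∈ G_v` with `t_w = diag(ϖ^{m_i})`,
`Λ_{s,v}(ι_v(t, 1)) = χ(ϖ_w)^{M⁺} · χ(ϖ_{w̄})^{M⁻} · ‖ϖ‖_w^{(M⁺+M⁻)(s+n/2)}`, `M^± = M·∑_i max(±m_i, 0)`.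
[cite: Li1992, §3 Thm. 3.1] [cite: GelbartPiatetskishapiroRallis1987, Part A §6] [cite: Liu2011, §2C p. 863] -/
theorem lambdaLoc_iotaLeftLocPi_diagonal_split (χ : HeckeCharacter L) (s : ℂ)
    (hχ : ∀ w : UnitaryGroup.PlacesOver L v, χ.IsUnramifiedAt w.1)
    (hdV0 : ∀ i, dV i ≠ 0) (hdW0 : ∀ j, dW j ≠ 0)
    (w : UnitaryGroup.PlacesOver L v) (hw : IsCMField.complexConj L • w.1 ≠ w.1)
    (hTw : ∀ i j, ValuativeRel.valuation (w.1.adicCompletion L)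
      (LocalSplitting.gramW (Fp L) L v n (T₀ := gramR L e dV hdV dW hdW) w i j) ≤ 1)
    (hTwd : ValuativeRel.valuation (w.1.adicCompletion L)
      (LocalSplitting.gramW (Fp L) L v n (T₀ := gramR L e dV hdV dW hdW) w).det = 1)
    {ϖ : w.1.adicCompletion L} (hϖ : Valued.v ϖ = WithZero.exp (-1 : ℤ)) (m : Fin N → ℤ)
    (t : UnitaryGroup.localPi L (IsCMField.complexConj L) N (Matrix.diagonal dV) v)
    (ht : Units.val ((t : UnitaryGroup.LocalGLPi L N v) w) = Matrix.diagonal fun i => ϖ ^ m i) :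
    LambdaLoc L e dV hdV dW hdW v χ s (iotaLeftLocPi L e dV hdV dW hdW v t) =
      χ.valueAtUniformizer w.1 ^ (M * ∑ i, (m i).toNat) *
        χ.valueAtUniformizer (UnitaryGroup.PlacesOver.galInv (IsCMField.complexConj L) w).1 ^ (M * ∑ i, (-(m i)).toNat) *
        ((‖ϖ‖ ^ ((M * ∑ i, (m i).toNat) + M * ∑ i, (-(m i)).toNat) : ℝ) : ℂ) ^ (s + (n : ℂ) / 2) := by
  classical
  haveI : Algebra.IsQuadraticExtension (Fp L) L := IsCMField.isQuadraticExtension L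
  have hϖ0 : ϖ ≠ 0 := fun h0 => by rw [h0, map_zero] at hϖ; exact WithZero.exp_ne_zero hϖ.symm
  -- the exponents along `e`
  set m' : Fin n → ℤ := fun j => m (e.symm j).1 with hm'
  have hM₁ : ∑ j, (m' j).toNat = M * ∑ i, (m i).toNat := sum_comp_symm_fst e fun i => (m i).toNat
  have hM₂ : ∑ j, (-(m' j)).toNat = M * ∑ i, (-(m i)).toNat := sum_comp_symm_fst e fun i => (-(m i)).toNat
  -- the `w`-component of `ι_v(t, 1)`
  set a : Fin n → w.1.adicCompletion L := fun j => ϖ ^ m' j with ha_def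
  have ha : ∀ j, a j ≠ 0 := fun j => zpow_ne_zero _ hϖ0
  have hh : (((iotaLeftLocPi L e dV hdV dW hdW v t :
        UnitaryGroup.localPi L (IsCMField.complexConj L) (n + n) (hermD L e dV hdV dW hdW) v) :
          UnitaryGroup.LocalGLPi L (n + n) v) w : Matrix (Fin (n + n)) (Fin (n + n)) (w.1.adicCompletion L)) =
      Matrix.reindex (LocalSplitting.e₂ n) (LocalSplitting.e₂ n) (Matrix.fromBlocks (diagonal a) 0 0 1) := by
    rw [iotaLeftLocPi_apply, coe_iotaVLocPi_apply, ht]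
    have h1 : Units.val (((1 : UnitaryGroup.localPi L (IsCMField.complexConj L) N (Matrix.diagonal dV) v) :
        UnitaryGroup.LocalGLPi L N v) w) = 1 := rfl
    have h2 : (Matrix.diagonal fun i => ϖ ^ m i) ⊗ₖ (1 : Matrix (Fin M) (Fin M) (w.1.adicCompletion L)) =
        Matrix.diagonal fun p : Fin N × Fin M => ϖ ^ m p.1 := by
      rw [← Matrix.diagonal_one, Matrix.diagonal_kronecker_diagonal]
      simp only [mul_one]
    rw [h1, Matrix.one_kronecker_one, h2]
    simp only [Matrix.reindex_apply, Matrix.submatrix_diagonal_equiv, Matrix.submatrix_one_equiv]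
    rfl
  -- the explicit decomposition at the δ-package of the K2Lit datum
  obtain ⟨p, k, hp, hk, hpk, hd₁, hd₂⟩ :=
    exists_isSiegelDelta_mul_localInt_of_diagonal (Fp L) L (IsCMField.complexConj L) (complexConj_imagUnit L) (imagUnit_ne_zero L)
      (imagUnit_mul_self L) v n (gramR_isSymm L e dV hdV dW hdW) (isUnit_det_gramR₀ L e dV hdV hdV0 dW hdW hdW0)
      (hermD_eq_map_gramD L e dV hdV dW hdW) w hw hTw hTwd a ha _ hh
  have hp' : p ∈ siegelDeltaLoc L e dV hdV dW hdW v := (mem_siegelDeltaLoc_iff_local L e dV hdV dW hdW v p).2 hp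
  -- the two `det_Δ`'s
  have hP : ∀ j, ValuativeRel.valuation (w.1.adicCompletion L) (a j) ≤ 1 ↔ 0 ≤ m' j := fun j => valuation_zpow_le_one_iff L hϖ (m' j)
  rw [prod_ite_zpow_eq_pow_sum_toNat ϖ m' _ hP, hM₁] at hd₁
  rw [inv_prod_ite_zpow_eq_pow_sum_toNat ϖ m' _ hP, hM₂] at hd₂
  set B := LocalSplitting.detDelta (Fp L) L (IsCMField.complexConj L) v n (UnitaryGroup.PlacesOver.galInv (IsCMField.complexConj L) w) p
    with hB
  have hB0 : B ≠ 0 := fun h0 => by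
    rw [h0, map_zero] at hd₂
    exact pow_ne_zero _ hϖ0 hd₂.symm
  have hu₁ : IsUnit (LocalSplitting.detDelta (Fp L) L (IsCMField.complexConj L) v n w p) := by rw [hd₁]; exact (hϖ0.isUnit.pow _)
  have hu₂ : IsUnit B := hB0.isUnit
  -- unfold `Λ = siegelCharLoc p = χ_v(det_Δ p)|det_Δ p|^{s+n/2}` over the two places `w`, `c⁻¹ w`
  rw [hpk, lambdaLoc_mul_eq L e dV hdV dW hdW v χ s hχ hp' hk, siegelCharLoc_eq_localSiegelCharacter_of_mem L e dV hdV dW hdW v χ s hp',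
    LocalSiegelDoubled.localSiegelCharacter, LocalSiegelDoubled.absDetDelta, LocalSplitting.chiDet,
    LocalSplitting.univ_eq_pair (Fp L) L (IsCMField.complexConj L) (complexConj_imagUnit L) (imagUnit_ne_zero L) v w,
    Finset.prod_pair (UnitaryGroup.PlacesOver.galInv_ne (IsCMField.complexConj L) w hw).symm,
    Finset.prod_pair (UnitaryGroup.PlacesOver.galInv_ne (IsCMField.complexConj L) w hw).symm, dif_pos hu₁, dif_pos hu₂, Units.val_mul]
  -- the two character values
  have hχ₁ : ((χ.localComponent w.1 hu₁.unit : ℂˣ) : ℂ) = χ.valueAtUniformizer w.1 ^ (M * ∑ i, (m i).toNat) := by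
    rw [HeckeCharacter.localComponent_apply, HeckeCharacter.coe_map_localUnits_eq_valueAtUniformizer_zpow (hχ w), IsUnit.unit_spec, hd₁,
      neg_log_valued_pow L hϖ, zpow_natCast]
  have hvB : Valued.v B = Valued.v (ϖ ^ (M * ∑ i, (-(m i)).toNat)) := by
    rw [← hd₂, valued_galAdicCompletionMap]
  have hχ₂ : ((χ.localComponent (UnitaryGroup.PlacesOver.galInv (IsCMField.complexConj L) w).1 hu₂.unit : ℂˣ) : ℂ) =
      χ.valueAtUniformizer (UnitaryGroup.PlacesOver.galInv (IsCMField.complexConj L) w).1 ^ (M * ∑ i, (-(m i)).toNat) := by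
    rw [HeckeCharacter.localComponent_apply, HeckeCharacter.coe_map_localUnits_eq_valueAtUniformizer_zpow (hχ _), IsUnit.unit_spec, hvB,
      neg_log_valued_pow L hϖ, zpow_natCast]
  -- the two absolute values
  have hn : ‖LocalSplitting.detDelta (Fp L) L (IsCMField.complexConj L) v n w p‖ * ‖B‖ =
      ‖ϖ‖ ^ ((M * ∑ i, (m i).toNat) + M * ∑ i, (-(m i)).toNat) := by
    rw [hd₁, ← norm_galAdicCompletionMap (IsCMField.complexConj L) (smul_inv_smul (IsCMField.complexConj L) w.1) B, hd₂, norm_pow,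
      norm_pow, pow_add]
  rw [hχ₁, hχ₂, hn]

end Summit.HodgeConjecture.HodgeConjecture.Cruxes.HLiu418.K2LiuUnramifiedSectionOnCartan

end
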